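import Literature.Combinatorics.SimpleGraph.FundamentalCyclesCuts
import Literature.Combinatorics.SimpleGraph.FlowSpace
import HarnessLib

/-!
# A forest carries no non-zero finitely supported 1-cycle, with coefficients in any module
# (Biggs Thm 4.5 / Ch. 7; Godsil–Royle Thm 14.2.2) — infinite graphs allowed

The classical fact «the cycle-subspace of a forest is `0`» (Biggs, *Algebraic Graph Theory*
[Biggs1974], Theorem 4.5 with Ch. 7 «a graph whose co-rank is zero is a forest» and Proposition 5.4;
Godsil–Royle [GodsilRoyle2001], Theorem 14.2.2: the support of a non-zero flow «contains a cycle»)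
is in the tree as ★ `Orientation.flowSpace_eq_bot_of_isAcyclic` (`MinimalSupportFlows`) for a
FINITE graph (`[Fintype V] [Fintype G.edgeSet]`) and FIELD coefficients, by the dimension count
`dim ker D = m − n + c`.  This file proves the same statement in the generality used by cellular
chain complexes on infinite trees (e.g. the Bruhat–Tits tree of a rank-one group, where the
coefficient system of a smooth representation `V` lives inside the one vector space `V` and the
chains are finitely supported): for an ACYCLIC simple graph on an ARBITRARY vertex type, any
orientation `σ`, any ring `R` and any `R`-module `M`, a finitely supported `c : G.edgeSet →₀ M` whose
boundary `u ↦ ∑_e D_{ue} • c e` vanishes at every vertex is `0`.  The proof is the fundamental-cut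
argument of Biggs Lemma 5.1 (2) / GR Lemma 14.1.3 (★ `fundShore`, `tail_not_mem_fundShore`,
`head_mem_fundShore_iff_of_mem`): pairing the boundary against the indicator of the shore of the
head of an edge `e₀` in `G ∖ e₀` («discrete Stokes») returns the coefficient `c e₀`.

## What is formalised (vocabulary of `OrientedIncidenceMatrix` / `FlowSpace` / `FundamentalCyclesCuts`)

* `sum_smul_finsuppBoundary_eq` — discrete Stokes: `∑_{u ∈ A} y u • (∂c)(u) = ∑_e (y(head e) − y(tail e)) • c e`
  for every `0`-cochain `y : V → R` and every finite vertex set `A` containing the ends of the support;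
* `finsupp_sum_sub_smul_eq_zero_of_boundary_eq_zero` — hence a cycle pairs to `0` with every `y`;
* **`finsupp_eq_zero_of_isAcyclic`** — the theorem: on a forest a finitely supported 1-cycle with
  coefficients in any module is `0`; `eq_zero_of_isAcyclic_of_sum_smul_eq_zero` — the same for plain
  functions on a finite edge set;
* `mulVec_incMatrix_injective_of_isAcyclic`, `flowSpace_eq_bot_of_isAcyclic_ring` — the scalar
  corollaries over any COMMUTATIVE RING (`ℤ`, `ZMod n`, …) for a finite edge set and arbitrary vertex
  type; `flowSpace_eq_bot_iff_isAcyclic_ring` — with the converse (a cycle gives the non-zero flow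
  ★ `walkVec`) over non-trivial commutative rings.

Theorems only; no definitions, no `sorry`, no named facts.
-/

open Finset SimpleGraph
open scoped Matrix

namespace Literature.Combinatorics.SimpleGraph.OrientedIncidence.Orientation

variable {V : Type*} {G : SimpleGraph V} (σ : Orientation G)

/-! ### §1 Discrete Stokes for finitely supported 1-chains -/

section Stokes

variable (R : Type*) [Ring R] [DecidableEq V] {M : Type*} [AddCommGroup M] [Module R M]

/-- For a single edge `e` and a finite vertex set `A` containing both ends of `e`:
`∑_{u ∈ A} y u · D_{ue} = y(head e) − y(tail e)` (a column of `D` has `+1` at the head, `−1` at the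
tail, `0` elsewhere).
[cite: GodsilRoyle2001, §8.3 (p. 167)]
[cite: Biggs1974, Definition 4.2] -/
theorem sum_mul_incMatrix_of_mem (e : G.edgeSet) (y : V → R) (A : Finset V)
    (hh : σ.head e ∈ A) (ht : σ.tail e ∈ A) :
    ∑ u ∈ A, y u * σ.incMatrix R u e = y (σ.head e) - y (σ.tail e) := by
  rw [Finset.sum_eq_add_of_mem (σ.head e) (σ.tail e) hh ht (σ.head_ne_tail e)]
  · rw [incMatrix_head, incMatrix_tail, mul_one, mul_neg_one, sub_eq_add_neg]
  · rintro u - ⟨h1, h2⟩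
    rw [incMatrix_apply, if_neg h1, if_neg h2, sub_zero, mul_zero]

/-- **Discrete Stokes.** For a finitely supported `1`-chain `c : G.edgeSet →₀ M`, a `0`-cochain
`y : V → R` and any finite vertex set `A` containing the ends of the edges in the support of `c`:
`∑_{u ∈ A} y u • (∂c)(u) = ∑_e (y(head e) − y(tail e)) • c e`, where `(∂c)(u) = ∑_e D_{ue} • c e` is
the boundary (the incidence mapping of Biggs Definition 4.2 applied to `c`).
[cite: Biggs1974, Definition 4.2 with Proposition 4.3 (proof)]
[cite: GodsilRoyle2001, §8.3, §14.1 (`x ↦ Dx`)] -/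
theorem sum_smul_finsuppBoundary_eq (c : G.edgeSet →₀ M) (y : V → R) (A : Finset V)
    (hA : ∀ e ∈ c.support, σ.head e ∈ A ∧ σ.tail e ∈ A) :
    ∑ u ∈ A, y u • (c.sum fun e m => σ.incMatrix R u e • m) =
      c.sum fun e m => (y (σ.head e) - y (σ.tail e)) • m := by
  simp only [Finsupp.sum, Finset.smul_sum, smul_smul]
  rw [Finset.sum_comm]
  refine Finset.sum_congr rfl fun e he => ?_
  rw [← Finset.sum_smul, σ.sum_mul_incMatrix_of_mem R e y A (hA e he).1 (hA e he).2]

/-- A finitely supported `1`-chain with boundary zero pairs to zero with every `0`-cochain: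
`∑_e (y(head e) − y(tail e)) • c e = 0`.
[cite: Biggs1974, Definition 4.2, Theorem 4.5]
[cite: GodsilRoyle2001, §14.2 (`Dx = 0`)] -/
theorem finsupp_sum_sub_smul_eq_zero_of_boundary_eq_zero (c : G.edgeSet →₀ M)
    (h : ∀ u : V, (c.sum fun e m => σ.incMatrix R u e • m) = 0) (y : V → R) :
    (c.sum fun e m => (y (σ.head e) - y (σ.tail e)) • m) = 0 := by
  rw [← σ.sum_smul_finsuppBoundary_eq R c y (c.support.image σ.head ∪ c.support.image σ.tail)]
  · exact Finset.sum_eq_zero fun u _ => by rw [h u, smul_zero]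
  · intro e he
    exact ⟨Finset.mem_union_left _ (Finset.mem_image_of_mem _ he),
      Finset.mem_union_right _ (Finset.mem_image_of_mem _ he)⟩

end Stokes

/-! ### §2 A forest has no non-zero finitely supported 1-cycle -/

section Forest

variable (R : Type*) [Ring R] [DecidableEq V] {M : Type*} [AddCommGroup M] [Module R M]

omit [DecidableEq V] in
/-- The **fundamental-cut test** on a forest: pairing a finitely supported `1`-chain `c` against the
indicator of the shore of the head of `e₀` in `G ∖ e₀` returns the coefficient `c e₀` — every other
edge has both ends on the same side (★ `head_mem_fundShore_iff_of_mem`), `e₀` has its head inside and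
its tail outside (★ `tail_not_mem_fundShore`: the edges of a forest are bridges).
GR: «`e` is in the cut `C(T,e)` but not in any of the cuts `C(T,f)` for `f ≠ e`».
[cite: Biggs1974, Lemma 5.1 (2), Theorem 5.2 (2)]
[cite: GodsilRoyle2001, Lemma 14.1.3 (proof)] -/
theorem finsupp_sum_fundShore_indicator (hG : G.IsAcyclic) (c : G.edgeSet →₀ M) (e₀ : G.edgeSet)
    [DecidablePred (· ∈ σ.fundShore G e₀)] :
    (c.sum fun e m =>
        ((if σ.head e ∈ σ.fundShore G e₀ then (1 : R) else 0) -
          (if σ.tail e ∈ σ.fundShore G e₀ then (1 : R) else 0)) • m) = c e₀ := by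
  classical
  rw [Finsupp.sum, Finset.sum_eq_single e₀]
  · rw [if_pos (σ.head_mem_fundShore G e₀), if_neg (σ.tail_not_mem_fundShore G hG e₀.2), sub_zero,
      one_smul]
  · intro e _ hne
    by_cases h : σ.head e ∈ σ.fundShore G e₀
    · rw [if_pos h, if_pos ((σ.head_mem_fundShore_iff_of_mem G e.2 hne).1 h), sub_self, zero_smul]
    · rw [if_neg h, if_neg (fun h' => h ((σ.head_mem_fundShore_iff_of_mem G e.2 hne).2 h')), sub_self,
        zero_smul]
  · intro he₀
    rw [Finsupp.notMem_support_iff.1 he₀, smul_zero]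

/-- **A forest carries no non-zero finitely supported `1`-cycle, whatever the coefficients.** For an
acyclic simple graph on an arbitrary vertex type, an orientation `σ`, a ring `R` and an `R`-module
`M`: a finitely supported `c : G.edgeSet →₀ M` with `∑_e D_{ue} • c e = 0` at every vertex `u` is `0`
(the cycle-subspace of a forest is `0` — Biggs Thm 4.5 with «a graph whose co-rank is zero is a
forest»; GR Thm 14.2.2: the support of a non-zero flow contains a cycle).  Infinite-graph,
module-coefficient form of ★ `flowSpace_eq_bot_of_isAcyclic`; proof by the fundamental-cut test.
[cite: Biggs1974, Theorem 4.5 with Ch. 7 and Proposition 5.4 (proof)]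
[cite: GodsilRoyle2001, Theorem 14.2.2 (proof)] -/
theorem finsupp_eq_zero_of_isAcyclic (hG : G.IsAcyclic) (c : G.edgeSet →₀ M)
    (h : ∀ u : V, (c.sum fun e m => σ.incMatrix R u e • m) = 0) : c = 0 := by
  classical
  ext e₀
  rw [Finsupp.zero_apply, ← σ.finsupp_sum_fundShore_indicator R hG c e₀]
  exact σ.finsupp_sum_sub_smul_eq_zero_of_boundary_eq_zero R c h
    (fun u => if u ∈ σ.fundShore G e₀ then (1 : R) else 0)

/-- The boundary of a finitely supported `1`-chain on a forest determines the chain (injectivity of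
`∂₁ : C₁ → C₀` for finitely supported chains with coefficients in any module).
[cite: Biggs1974, Theorem 4.5 with Ch. 7]
[cite: GodsilRoyle2001, Theorem 14.2.2] -/
theorem finsupp_boundary_injective_of_isAcyclic (hG : G.IsAcyclic) :
    Function.Injective fun c : G.edgeSet →₀ M =>
      fun u : V => (c.sum fun e m => σ.incMatrix R u e • m) := by
  intro c c' hcc'
  rw [← sub_eq_zero]
  refine σ.finsupp_eq_zero_of_isAcyclic R hG (c - c') fun u => ?_
  have hu := congr_fun hcc' u
  simp only at hu
  rw [Finsupp.sum_sub_index (fun e m₁ m₂ => smul_sub (σ.incMatrix R u e) m₁ m₂), hu, sub_self]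

/-- Finite edge set, plain functions: on a forest, `c : G.edgeSet → M` with `∑_e D_{ue} • c e = 0` at
every vertex is `0` (arbitrary vertex type, any module of coefficients).
[cite: Biggs1974, Theorem 4.5 with Ch. 7]
[cite: GodsilRoyle2001, Theorem 14.2.2] -/
theorem eq_zero_of_isAcyclic_of_sum_smul_eq_zero [Fintype G.edgeSet] (hG : G.IsAcyclic)
    (c : G.edgeSet → M) (h : ∀ u : V, ∑ e, σ.incMatrix R u e • c e = 0) : c = 0 := by
  have hc : Finsupp.equivFunOnFinite.symm c = 0 := by
    refine σ.finsupp_eq_zero_of_isAcyclic R hG _ fun u => ?_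
    rw [Finsupp.sum_fintype _ _ (fun e => smul_zero _)]
    simp only [Finsupp.coe_equivFunOnFinite_symm]
    exact h u
  rw [← Finsupp.coe_equivFunOnFinite_symm c, hc, Finsupp.coe_zero]

end Forest

/-! ### §3 Scalar corollaries over commutative rings -/

section Ring

variable (R : Type*) [CommRing R] [DecidableEq V] [Fintype G.edgeSet]

/-- **On a forest the incidence mapping `x ↦ Dx` is injective on the edge space** — over any
commutative ring of coefficients (in particular `ℤ`: a forest carries no non-zero integral flow) and
for an arbitrary vertex type.
[cite: Biggs1974, Theorem 4.5 with Ch. 7]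
[cite: GodsilRoyle2001, Theorem 14.2.2] -/
theorem mulVec_incMatrix_injective_of_isAcyclic (hG : G.IsAcyclic) :
    Function.Injective (σ.incMatrix R).mulVec := by
  intro x x' hxx'
  rw [← sub_eq_zero]
  refine σ.eq_zero_of_isAcyclic_of_sum_smul_eq_zero R hG (x - x') fun u => ?_
  have hu := congr_fun hxx' u
  simp only [Matrix.mulVec, dotProduct] at hu
  simp only [Pi.sub_apply, smul_eq_mul, mul_sub, Finset.sum_sub_distrib, hu, sub_self]

/-- **The cycle-subspace of a forest is `0` over any commutative ring** (`ker D = 0`; finite edge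
set, arbitrary vertex type) — the ring-coefficient form of ★ `flowSpace_eq_bot_of_isAcyclic`.
Biggs Ch. 7: «a graph whose co-rank is zero is a forest».
[cite: Biggs1974, Theorem 4.5 with Ch. 7 and Proposition 5.4 (proof)]
[cite: GodsilRoyle2001, Theorem 14.2.2] -/
theorem flowSpace_eq_bot_of_isAcyclic_ring (hG : G.IsAcyclic) : σ.flowSpace R = ⊥ := by
  rw [Submodule.eq_bot_iff]
  intro x hx
  rw [mem_flowSpace_iff] at hx
  exact σ.mulVec_incMatrix_injective_of_isAcyclic R hG (by rw [hx, Matrix.mulVec_zero])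

/-- **`ker D = 0` iff the graph is a forest**, over any non-trivial commutative ring (finite edge
set, arbitrary vertex type): a cycle gives the non-zero flow ★ `walkVec`.
[cite: Biggs1974, Theorem 4.5 with Ch. 7]
[cite: GodsilRoyle2001, Theorem 14.2.2] -/
theorem flowSpace_eq_bot_iff_isAcyclic_ring [Nontrivial R] : σ.flowSpace R = ⊥ ↔ G.IsAcyclic := by
  refine ⟨fun h => ?_, σ.flowSpace_eq_bot_of_isAcyclic_ring R⟩
  intro u p hp
  have hmem := σ.walkVec_mem_flowSpace R p
  rw [h, Submodule.mem_bot] at hmem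
  exact σ.walkVec_ne_zero_of_isTrail R hp.isTrail hp.not_nil hmem

end Ring

end Literature.Combinatorics.SimpleGraph.OrientedIncidence.Orientation
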